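import Literature.NumberTheory.EllipticCurves.HeegnerModuleIndex
import Literature.NumberTheory.EllipticCurves.BSDSelmerPConverseHeegnerIndexZeroProofs
import Literature.NumberTheory.EllipticCurves.IwasawaSelmerDualProofs
import HarnessLib

/-!
# BirchSwinnertonDyer — crux `UBPotentiallyGood` (stmt-BirchSwinnertonDyer-15878), line `Sketch`,
# stub `stub_howardBound`: Howard's bound `corank ≤ 1 + 2 · ord_J 𝐋` from Theorem B (sorry-free)

Stub `stub_howardBound` of line `Sketch` (crux `ToricShedding.UBPotentiallyGood` =
`FrozenTwin.UBPotentiallyGood` = `DefiniteTheta.UBPotentiallyGood`) is VERBATIM the universal closure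
of the tree's named fact `Howard2004_selmerCorank_le N W K p κ γ jbar` (B. Howard, *The Heegner point
Kolyvagin system*, Compositio Math. 140 (2004), §1 eq. (2)): under `HowardHypotheses`, for every
`Λ`-adic Selmer datum `D` and Heegner family `F`,
`corank_{ℤ_p} Sel_{p^∞}(E/K) ≤ 1 + 2 · heegnerModuleIndex D F` in `ℕ∞`. Howard's printed proof is one
sentence: "part (c) of the theorem [Thm. B], together with the control theorem, gives the
inequality `rank_{ℤ_p} S_p(E/K) ≤ 1 + 2 · ord_J(𝐋)`". This file runs that sentence in the tree,
reducing the stub to the tree's record of **Theorem B alone** (`Howard2004_thmB`, UNPROVED named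
fact, taken as a HYPOTHESIS — never vendored here); the control theorem enters only through its
PROVED easy half `WeierstrassCurve.selmerCorank_le_coinvariantsRank`
(`corank Sel_{p^∞}(E/K) ≤ rank_{ℤ_p} X/TX`, Greenberg LNM 1716 Lemma 3.1), and the existence of the
Iwasawa module `X` is the PROVED `WeierstrassCurve.selmerDualData`:

  `corank Sel_{p^∞}(E/K) ≤ rank_{ℤ_p} X_Γ`                       (control, easy half; proved)
  `               ≤ 1 + ℓ_T(X_tors)`                            (`rank_Λ X = 1`, Thm. B (b))
  `               ≤ 1 + 2 · ℓ_T(S/ℋ_∞) = 1 + 2 · a(E, K, p)`    (`char X_tors ∣ I(ℋ_∞)²`, Thm. B (c)),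

where `ℓ_T` is the local length at the augmentation prime `J = (γ - 1) = (T)` (`primeT p`). The two
module-theoretic lemmas in the middle are proved here for abstract `Λ = ℤ_p⟦T⟧`-modules:
`rank_{ℤ_p} Q/TQ = 1` for `Q` finitely generated torsion-free of rank one (snake lemma for `× T` on
`0 → Λ → Q → Q/Λx → 0` and `ℓ_T(C[T]) = ℓ_T(C/TC)` for the torsion cokernel `C`), whence
`rank_{ℤ_p} X/TX ≤ rank_Λ X + ℓ_T(X_tors)` at rank one; and `ℓ_T(X_t) ≤ 2 ℓ_T(N)` whenever
`char(X_t) ∣ char(N)²` (`ord_T` of a characteristic generator is the local length; a non-torsion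
`N` has `ℓ_T(N) = ⊤`).

Landed decls (all sorry-free; the named facts appear only as hypotheses):
* `howard2004_selmerCorank_le_of_thmB : Howard2004_thmB N W K p κ γ jbar →
    Howard2004_selmerCorank_le N W K p κ γ jbar` — the reduction (eq. (2) ⇐ Thm. B);
* `ubPotentiallyGood_stub_howardBound_of_fact` — the registered stub statement ⇐ the universal
  closure of `Howard2004_selmerCorank_le` (definitional);
* `ubPotentiallyGood_stub_howardBound_of_thmB` — the registered stub statement ⇐ the universal
  closure of `Howard2004_thmB`.

References: Howard 2004, §1 Thm. B and eq. (2) (held: `paper:arxiv-1202.6340`, pp. 1–2);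
Greenberg, LNM 1716 (1999), §1 p. 65 and Lemma 3.1; Perrin-Riou, Bull. SMF 115 (1987), §1 p. 405;
Washington, *Introduction to Cyclotomic Fields*, §13.2.
-/

-- D-0017: single-problem summit, so `Summit.BirchSwinnertonDyer.BirchSwinnertonDyer.…` repeats a
-- namespace BY DESIGN.
set_option linter.dupNamespace false

noncomputable section

open scoped Classical

universe u v

namespace Summit.BirchSwinnertonDyer.BirchSwinnertonDyer.Theorems

open Literature.NumberTheory.EllipticCurves Literature.NumberTheory.EllipticCurves.IwasawaAlgebra
  WeierstrassCurve

/-! ### Module theory over `Λ = ℤ_p⟦T⟧` at the augmentation prime `𝔭 = (T)` -/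

section Algebra

variable (p : ℕ) [Fact p.Prime]

/-- **`ℓ_T(Λ) = ⊤`**: the Iwasawa algebra has infinite local length at `𝔭 = (T)` (from
`0 → Λ →(×T) Λ → Λ/TΛ → 0`: `ℓ_T(Λ) = ℓ_T(Λ) + 1`). Washington §13.2. [folklore] -/
theorem howardBound_lengthAt_primeT_self_eq_top :
    Module.lengthAt (IwasawaAlgebra p) (IwasawaAlgebra p) (primeT p) = ⊤ := by
  have hinj : Function.Injective (mulX (p := p) (IwasawaAlgebra p)) := by
    intro a b hab
    rw [mulX_apply, mulX_apply, smul_eq_mul, smul_eq_mul] at hab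
    exact mul_left_cancel₀ PowerSeries.X_ne_zero hab
  have h := Module.lengthAt_eq_add_of_exact (mulX (p := p) (IwasawaAlgebra p))
    (TSubmodule p (IwasawaAlgebra p)).mkQ hinj (Submodule.mkQ_surjective _)
    (exact_mulX_mkQ (IwasawaAlgebra p)) (primeT p)
  have h1 : Module.lengthAt (IwasawaAlgebra p) (IwasawaAlgebra p ⧸ TSubmodule p (IwasawaAlgebra p))
      (primeT p) = 1 := lengthAt_coinvariants_self p
  rw [h1] at h
  by_contra hne
  obtain ⟨n, hn⟩ := ENat.ne_top_iff_exists.mp hne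
  rw [← hn] at h
  have h' : n = n + 1 := by exact_mod_cast h
  omega

/-- **A non-torsion `Λ`-module has `ℓ_T = ⊤`.** If `M` is not `Λ`-torsion it contains an element
`x` with trivial annihilator, so `Λ ↪ M` (`a ↦ a x`) and `ℓ_T(M) ≥ ℓ_T(Λ) = ⊤`. In Howard's bound
this is the trivial case `ℋ_∞ = 0` / `S/ℋ_∞` not torsion, where `ord_J I(ℋ_∞) = ⊤`.
Bourbaki AC VII §4.4; Washington §13.2. [folklore] -/
theorem howardBound_lengthAt_primeT_eq_top_of_not_isTorsion {M : Type v} [AddCommGroup M]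
    [Module (IwasawaAlgebra p) M] (hM : ¬ Module.IsTorsion (IwasawaAlgebra p) M) :
    Module.lengthAt (IwasawaAlgebra p) M (primeT p) = ⊤ := by
  unfold Module.IsTorsion at hM
  obtain ⟨x, hx⟩ := not_forall.mp hM
  have hinj : Function.Injective (LinearMap.toSpanSingleton (IwasawaAlgebra p) M x) := by
    rw [injective_iff_map_eq_zero]
    intro a ha
    rw [LinearMap.toSpanSingleton_apply] at ha
    by_contra ha0
    exact hx ⟨⟨a, mem_nonZeroDivisors_of_ne_zero ha0⟩, ha⟩
  have hle := Module.lengthAt_le_of_injective _ hinj (primeT p)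
  rw [howardBound_lengthAt_primeT_self_eq_top p] at hle
  exact eq_top_iff.mpr hle

/-- **`rank_{ℤ_p} Q/TQ = 1` for `Q` finitely generated, torsion-free, of `Λ`-rank one**
(`ℓ_T(Q_Γ) = 1`). Pick `x ≠ 0`; `0 → Λ → Q → C → 0` (`a ↦ a x`) has torsion cokernel `C`, and the
snake lemma for multiplication by `T` gives `0 = Q[T] → C[T] →δ Λ_Γ → Q_Γ → C_Γ → 0`, so
`ℓ_T(Q_Γ) + ℓ_T(C[T]) = ℓ_T(Λ_Γ) + ℓ_T(C_Γ) = 1 + ℓ_T(C_Γ)`, while `ℓ_T(C[T]) = ℓ_T(C_Γ) < ∞` for the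
finitely generated torsion `C`. (This is the upper half of "`rank_Λ X` counts the `Λ`-summands of
`X/TX`"; the lower half `ℓ_T(Q_Γ) ≥ 1` is the tree's `one_le_lengthAt_coinvariants_of_isTorsionFree`.)
Washington §13.2; Greenberg LNM 1716, §1 p. 65. [folklore] -/
theorem howardBound_lengthAt_coinvariants_eq_one_of_finrank_eq_one {Q : Type v} [AddCommGroup Q]
    [Module (IwasawaAlgebra p) Q] [Module.Finite (IwasawaAlgebra p) Q]
    [Module.IsTorsionFree (IwasawaAlgebra p) Q]
    (hQ1 : Module.finrank (IwasawaAlgebra p) Q = 1) :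
    Module.lengthAt (IwasawaAlgebra p) (coinvariants p Q) (primeT p) = 1 := by
  haveI : NoZeroSMulDivisors (IwasawaAlgebra p) Q := ⟨fun h ↦ smul_eq_zero.mp h⟩
  -- a nonzero element and the sequence `0 → Λ → Q → C → 0`
  haveI : Nontrivial Q :=
    (Module.finrank_pos_iff (R := IwasawaAlgebra p)).mp (by rw [hQ1]; exact Nat.one_pos)
  obtain ⟨x, hx⟩ := exists_ne (0 : Q)
  set f : IwasawaAlgebra p →ₗ[IwasawaAlgebra p] Q := LinearMap.toSpanSingleton (IwasawaAlgebra p) Q x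
    with hf_def
  set g : Q →ₗ[IwasawaAlgebra p] Q ⧸ Submodule.span (IwasawaAlgebra p) {x} :=
    (Submodule.span (IwasawaAlgebra p) {x}).mkQ with hg_def
  have hf : Function.Injective f := by
    rw [injective_iff_map_eq_zero]
    intro a ha
    rw [hf_def, LinearMap.toSpanSingleton_apply] at ha
    exact (smul_eq_zero.mp ha).resolve_right hx
  have hg : Function.Surjective g := Submodule.mkQ_surjective _
  have hfg : Function.Exact f g := by
    rw [LinearMap.exact_iff, hg_def, Submodule.ker_mkQ, hf_def, LinearMap.span_singleton_eq_range]
  -- the cokernel `C` is finitely generated torsion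
  set C := Q ⧸ Submodule.span (IwasawaAlgebra p) {x}
  have hC : Module.IsTorsion (IwasawaAlgebra p) C :=
    isTorsion_quotient_span_singleton_of_finrank_eq_one p hQ1 hx
  have hCfin : Module.lengthAt (IwasawaAlgebra p) (invariants p C) (primeT p) ≠ ⊤ :=
    ne_top_of_le_ne_top (lengthAt_primeT_ne_top C hC) (Module.lengthAt_submodule_le _ _)
  have hCeq : Module.lengthAt (IwasawaAlgebra p) (invariants p C) (primeT p) =
      Module.lengthAt (IwasawaAlgebra p) (coinvariants p C) (primeT p) :=
    lengthAt_invariants_eq_lengthAt_coinvariants p C hC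
  -- the snake `C[T] →δ Λ_Γ → Q_Γ → C_Γ → 0`, with `δ` injective since `Q[T] = 0`
  set δ := snakeDelta f g hf hg hfg
  have hδ : Function.Injective δ := by
    rw [injective_iff_map_eq_zero]
    intro z hz
    obtain ⟨w, rfl⟩ := ((exact_invariantsMap_snakeDelta f g hf hg hfg) z).mp hz
    have hw : (w : Q) = 0 := by
      have h2 := (mem_invariants_iff p Q (w : Q)).mp w.2
      exact (smul_eq_zero.mp h2).resolve_left PowerSeries.X_ne_zero
    have hw0 : w = 0 := Subtype.ext hw
    rw [hw0, map_zero]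
  -- `ℓ(Λ_Γ) = ℓ(range δ) + ℓ(range f_Γ)` and `range δ ≃ C[T]`
  set φ := coinvariantsMap (p := p) f
  set ψ := coinvariantsMap (p := p) g
  have hkerφ : LinearMap.ker φ = LinearMap.range δ :=
    LinearMap.exact_iff.mp (exact_snakeDelta_coinvariantsMap f g hf hg hfg)
  have hkerψ : LinearMap.ker ψ = LinearMap.range φ :=
    LinearMap.exact_iff.mp (exact_coinvariantsMap f g hg hfg)
  have hΛ : Module.lengthAt (IwasawaAlgebra p) (coinvariants p (IwasawaAlgebra p)) (primeT p) =
      Module.lengthAt (IwasawaAlgebra p) (LinearMap.ker φ) (primeT p) +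
        Module.lengthAt (IwasawaAlgebra p) (LinearMap.range φ) (primeT p) :=
    Module.lengthAt_eq_add_of_exact (LinearMap.ker φ).subtype φ.rangeRestrict
      (Submodule.subtype_injective _) φ.surjective_rangeRestrict
      (LinearMap.exact_iff.mpr (by rw [LinearMap.ker_rangeRestrict, Submodule.range_subtype])) _
  have hQ : Module.lengthAt (IwasawaAlgebra p) (coinvariants p Q) (primeT p) =
      Module.lengthAt (IwasawaAlgebra p) (LinearMap.ker ψ) (primeT p) +
        Module.lengthAt (IwasawaAlgebra p) (coinvariants p C) (primeT p) :=
    Module.lengthAt_eq_add_of_exact (LinearMap.ker ψ).subtype ψ (Submodule.subtype_injective _)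
      (coinvariantsMap_surjective g hg) (LinearMap.exact_subtype_ker_map ψ) _
  have hrange : Module.lengthAt (IwasawaAlgebra p) (LinearMap.ker φ) (primeT p) =
      Module.lengthAt (IwasawaAlgebra p) (invariants p C) (primeT p) := by
    rw [hkerφ]
    exact (Module.lengthAt_eq_of_linearEquiv (LinearEquiv.ofInjective δ hδ) (primeT p)).symm
  rw [hrange, lengthAt_coinvariants_self p] at hΛ
  rw [hkerψ] at hQ
  -- `ℓ(Q_Γ) + ℓ(C[T]) = ℓ(range f_Γ) + ℓ(C_Γ) + ℓ(C[T]) = 1 + ℓ(C_Γ)`; cancel `ℓ(C[T]) = ℓ(C_Γ)`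
  set i := Module.lengthAt (IwasawaAlgebra p) (invariants p C) (primeT p)
  set r := Module.lengthAt (IwasawaAlgebra p) (LinearMap.range φ) (primeT p)
  have hsum : i + Module.lengthAt (IwasawaAlgebra p) (coinvariants p Q) (primeT p) = i + 1 := by
    rw [hQ, ← hCeq, hΛ]
    ring
  exact WithTop.add_left_cancel hCfin hsum

/-- **`rank_{ℤ_p} X/TX ≤ 1 + ℓ_T(X_tors)` for a finitely generated `Λ`-module `X` of rank one**
(Howard's "`X ∼ Λ ⊕ M ⊕ M`" enters only through `rank_Λ X = 1`; `X_tors = Submodule.torsion`).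
From the right exact `(X_tors)_Γ → X_Γ → Q_Γ → 0`, `Q = X/X_tors` torsion-free of rank one:
`ℓ_T(X_Γ) ≤ ℓ_T((X_tors)_Γ) + ℓ_T(Q_Γ) ≤ ℓ_T(X_tors) + 1`. Howard 2004, §1 (the step "by Mazur's
control theorem one has `rank_{ℤ_p} X/(γ-1)X = corank`" feeds this count); Washington §13.2.
[cite: Howard2004HeegnerKolyvagin, §1 eq. (2)] -/
theorem howardBound_coinvariantsRank_le_one_add_lengthAt_torsion {X : Type v} [AddCommGroup X]
    [Module (IwasawaAlgebra p) X] [Module.Finite (IwasawaAlgebra p) X]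
    (hX1 : Module.finrank (IwasawaAlgebra p) X = 1) :
    (coinvariantsRank p X : ℕ∞) ≤
      1 + Module.lengthAt (IwasawaAlgebra p) (Submodule.torsion (IwasawaAlgebra p) X) (primeT p) := by
  set Xt := Submodule.torsion (IwasawaAlgebra p) X with hXt
  -- `Q = X / X_tors` is torsion-free of rank one
  have hrk : Module.rank (IwasawaAlgebra p) (X ⧸ Xt) = 1 := by
    have hsum := rank_quotient_add_rank_of_isDomain Xt
    have ht : Module.rank (IwasawaAlgebra p) Xt = 0 :=
      rank_eq_zero_iff_isTorsion.mpr (Submodule.torsion_isTorsion (R := IwasawaAlgebra p) (M := X))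
    have hX : Module.rank (IwasawaAlgebra p) X = 1 := by
      rw [← Module.finrank_eq_rank, hX1, Nat.cast_one]
    rwa [ht, add_zero, hX] at hsum
  have hQ1 : Module.finrank (IwasawaAlgebra p) (X ⧸ Xt) = 1 :=
    Module.finrank_eq_of_rank_eq (by rw [hrk, Nat.cast_one])
  have hQ := howardBound_lengthAt_coinvariants_eq_one_of_finrank_eq_one p hQ1
  -- right exactness of `Γ`-coinvariants
  have hexact := exact_coinvariantsMap Xt.subtype Xt.mkQ (Submodule.mkQ_surjective _)
    (LinearMap.exact_subtype_mkQ Xt)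
  have hle := Module.lengthAt_le_add_of_exact _ _ hexact (primeT p)
  rw [lengthAt_coinvariants_eq_coinvariantsRank p X, hQ] at hle
  have ht : Module.lengthAt (IwasawaAlgebra p) (coinvariants p Xt) (primeT p) ≤
      Module.lengthAt (IwasawaAlgebra p) Xt (primeT p) :=
    Module.lengthAt_quotient_le _ _
  calc (coinvariantsRank p X : ℕ∞)
      ≤ Module.lengthAt (IwasawaAlgebra p) (coinvariants p Xt) (primeT p) + 1 := hle
    _ ≤ Module.lengthAt (IwasawaAlgebra p) Xt (primeT p) + 1 := by gcongr
    _ = 1 + Module.lengthAt (IwasawaAlgebra p) Xt (primeT p) := add_comm _ _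

/-- **`ℓ_T(X_t) ≤ 2 · ℓ_T(N)` from `char(X_t) ∣ char(N)²`** for finitely generated `Λ`-modules with
`X_t` torsion (Howard's Thm. B (c) as vendored: `char(X_{Λ-tors}) ∣ I(ℋ_∞)²`). If `N` is torsion,
a generator `h` of the principal ideal `char(N)` has `ord_T h = ℓ_T(N)`
(`IwasawaAlgebra.order_eq_toNat_lengthAt`), `h² ∈ char(X_t)`, and `ℓ_T(X_t) ≤ ord_T(h²) = 2 ord_T h`
(`IwasawaAlgebra.lengthAt_primeT_le_order`); if `N` is not torsion, `ℓ_T(N) = ⊤`.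
Washington §13.2; Howard 2004, §1. [cite: Howard2004HeegnerKolyvagin, §1 Thm. B and eq. (2)] -/
theorem howardBound_lengthAt_primeT_le_two_mul_of_charIdeal_dvd_sq {Xt : Type u} {N : Type v}
    [AddCommGroup Xt] [Module (IwasawaAlgebra p) Xt] [Module.Finite (IwasawaAlgebra p) Xt]
    [AddCommGroup N] [Module (IwasawaAlgebra p) N] [Module.Finite (IwasawaAlgebra p) N]
    (hXt : Module.IsTorsion (IwasawaAlgebra p) Xt)
    (hdvd : Module.charIdeal (IwasawaAlgebra p) Xt ∣ Module.charIdeal (IwasawaAlgebra p) N ^ 2) :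
    Module.lengthAt (IwasawaAlgebra p) Xt (primeT p) ≤
      2 * Module.lengthAt (IwasawaAlgebra p) N (primeT p) := by
  by_cases hN : Module.IsTorsion (IwasawaAlgebra p) N
  · obtain ⟨h, hh⟩ := (charIdeal_isPrincipal_holds p N).principal
    have hh' : Module.charIdeal (IwasawaAlgebra p) N = Ideal.span {h} := hh
    have hord := order_eq_toNat_lengthAt p hN h hh' (primeT p) (primeT_asIdeal p)
    have hfin : Module.lengthAt (IwasawaAlgebra p) N (primeT p) ≠ ⊤ := lengthAt_primeT_ne_top N hN
    have hlen : Module.lengthAt (IwasawaAlgebra p) N (primeT p) = h.order := by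
      rw [hord, ENat.coe_toNat hfin]
    have hmem : h ^ 2 ∈ Module.charIdeal (IwasawaAlgebra p) Xt := by
      apply Ideal.le_of_dvd hdvd
      rw [hh']
      exact Ideal.pow_mem_pow (Ideal.mem_span_singleton_self h) 2
    calc Module.lengthAt (IwasawaAlgebra p) Xt (primeT p)
        ≤ (h ^ 2).order := lengthAt_primeT_le_order Xt hXt (h ^ 2) hmem
      _ = h.order + h.order := by rw [pow_two, PowerSeries.order_mul]
      _ = 2 * Module.lengthAt (IwasawaAlgebra p) N (primeT p) := by rw [hlen, two_mul]
  · rw [howardBound_lengthAt_primeT_eq_top_of_not_isTorsion p hN]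
    simp

end Algebra

/-! ### Howard 2004, §1 eq. (2) from Theorem B -/

section Howard

variable (N : ℕ) [NeZero N] (W : WeierstrassCurve ℚ) [W.IsGloballyMinimal] (K : Type u) [Field K]
  [NumberField K] (p : ℕ) [Fact p.Prime] (κ : ZpExtension K p) (γ : Field.absoluteGaloisGroup K)
  (jbar : AlgebraicClosure K →+* ℂ)

/-- **Howard 2004, §1 eq. (2) from Theorem B** — the printed sentence "part (c) of the theorem,
together with the control theorem, gives the inequality `rank_{ℤ_p} S_p(E/K) ≤ 1 + 2 · ord_J(𝐋)`",
run in the tree: the named fact `Howard2004_selmerCorank_le N W K p κ γ jbar` follows from the named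
fact `Howard2004_thmB N W K p κ γ jbar` (hypothesis `hB`, UNPROVED in the tree, not vendored here).
With `X = Sel_{p^∞}(E/K_∞)^∨` the PROVED Iwasawa-module datum `WeierstrassCurve.selmerDualData`
(at the topological generator `γ` of `HowardHypotheses`):
`corank Sel_{p^∞}(E/K) ≤ rank_{ℤ_p} X/TX` (PROVED easy half of Mazur's control theorem,
`WeierstrassCurve.selmerCorank_le_coinvariantsRank`, Greenberg LNM 1716 Lemma 3.1)
`≤ 1 + ℓ_T(X_tors)` (Thm. B (b): `rank_Λ X = 1`;
`howardBound_coinvariantsRank_le_one_add_lengthAt_torsion`)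
`≤ 1 + 2 ℓ_T(S/ℋ_∞) = 1 + 2 · heegnerModuleIndex D F` (Thm. B (c): `char(X_tors) ∣ I(ℋ_∞)²`;
`howardBound_lengthAt_primeT_le_two_mul_of_charIdeal_dvd_sq`, `heegnerModuleIndex_def`).
CONDITIONAL on `hB`. [cite: Howard2004HeegnerKolyvagin, §1 eq. (2)] -/
theorem howard2004_selmerCorank_le_of_thmB (hB : Howard2004_thmB N W K p κ γ jbar) :
    Howard2004_selmerCorank_le N W K p κ γ jbar := by
  intro hyp D F
  haveI := hyp.isElliptic
  -- the Iwasawa module `X = Sel_{p^∞}(E/K_∞)^∨` (proved existence)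
  let X : (W.baseChange K).SelmerDualData κ γ := (W.baseChange K).selmerDualData κ hyp.topGenerator
  obtain ⟨⟨hSfin, -, -⟩, ⟨hXfin, hX1, hdvd⟩⟩ := hB hyp D F X
  haveI := hSfin
  haveI := hXfin
  -- (1) control theorem, easy half (proved)
  have h1 : (W.baseChange K).selmerCorank p ≤ coinvariantsRank p X.X :=
    (W.baseChange K).selmerCorank_le_coinvariantsRank hyp.topGenerator X
  -- (2) `rank_Λ X = 1`
  have h2 := howardBound_coinvariantsRank_le_one_add_lengthAt_torsion p hX1
  -- (3) `char(X_tors) ∣ I(ℋ_∞)²`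
  have hdvd' : Module.charIdeal (IwasawaAlgebra p) (Submodule.torsion (IwasawaAlgebra p) X.X) ∣
      Module.charIdeal (IwasawaAlgebra p) (D.S ⧸ heegnerModule D F) ^ 2 := hdvd
  have h3 := howardBound_lengthAt_primeT_le_two_mul_of_charIdeal_dvd_sq p
    (Submodule.torsion_isTorsion (R := IwasawaAlgebra p) (M := X.X)) hdvd'
  rw [heegnerModuleIndex_def]
  calc (((W.baseChange K).selmerCorank p : ℕ) : ℕ∞)
      ≤ (coinvariantsRank p X.X : ℕ∞) := by exact_mod_cast h1
    _ ≤ 1 + Module.lengthAt (IwasawaAlgebra p) (Submodule.torsion (IwasawaAlgebra p) X.X)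
          (primeT p) := h2
    _ ≤ 1 + 2 * Module.lengthAt (IwasawaAlgebra p) (D.S ⧸ heegnerModule D F) (primeT p) := by
        gcongr

end Howard

/-! ### The registered stub statement, conditionally -/

/-- **Stub `stub_howardBound` from the named fact `Howard2004_selmerCorank_le`** (Howard 2004, §1
eq. (2), UNPROVED in the tree, hypothesis `h` = its universal closure): the registered statement
verbatim — definitional. CONDITIONAL on `h`. [cite: Howard2004HeegnerKolyvagin, §1 eq. (2)] -/
theorem ubPotentiallyGood_stub_howardBound_of_fact
    (h : ∀ (N : ℕ) [NeZero N] (W : WeierstrassCurve ℚ) [W.IsGloballyMinimal] (K : Type) [Field K]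
      [NumberField K] (p : ℕ) [Fact p.Prime] (κ : ZpExtension K p)
      (γ : Field.absoluteGaloisGroup K) (jbar : AlgebraicClosure K →+* ℂ),
      Howard2004_selmerCorank_le N W K p κ γ jbar) :
    ∀ (N : ℕ) [NeZero N] (W : WeierstrassCurve ℚ) [W.IsGloballyMinimal] (K : Type) [Field K]
      [NumberField K] (p : ℕ) [Fact p.Prime] (κ : ZpExtension K p)
      (γ : Field.absoluteGaloisGroup K) (jbar : AlgebraicClosure K →+* ℂ),
      Literature.NumberTheory.EllipticCurves.Howard2004_selmerCorank_le N W K p κ γ jbar :=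
  h

/-- **Stub `stub_howardBound` from Theorem B** (Howard 2004, §1 Thm. B = Thm. 3.2.10, UNPROVED in
the tree, hypothesis `hB` = the universal closure of `Howard2004_thmB`): the registered statement
verbatim, by `howard2004_selmerCorank_le_of_thmB` at every `(N, W, K, p, κ, γ, jbar)`. This is the
exact remaining literature debt of the stub: Theorem B alone (the control theorem's easy half and
the existence of the Iwasawa module being proved in the tree). CONDITIONAL on `hB`.
[cite: Howard2004HeegnerKolyvagin, §1 Thm. B and eq. (2)] -/
theorem ubPotentiallyGood_stub_howardBound_of_thmB
    (hB : ∀ (N : ℕ) [NeZero N] (W : WeierstrassCurve ℚ) [W.IsGloballyMinimal] (K : Type) [Field K]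
      [NumberField K] (p : ℕ) [Fact p.Prime] (κ : ZpExtension K p)
      (γ : Field.absoluteGaloisGroup K) (jbar : AlgebraicClosure K →+* ℂ),
      Howard2004_thmB N W K p κ γ jbar) :
    ∀ (N : ℕ) [NeZero N] (W : WeierstrassCurve ℚ) [W.IsGloballyMinimal] (K : Type) [Field K]
      [NumberField K] (p : ℕ) [Fact p.Prime] (κ : ZpExtension K p)
      (γ : Field.absoluteGaloisGroup K) (jbar : AlgebraicClosure K →+* ℂ),
      Literature.NumberTheory.EllipticCurves.Howard2004_selmerCorank_le N W K p κ γ jbar :=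
  fun N _ W _ K _ _ p _ κ γ jbar ↦
    howard2004_selmerCorank_le_of_thmB N W K p κ γ jbar (hB N W K p κ γ jbar)

end Summit.BirchSwinnertonDyer.BirchSwinnertonDyer.Theorems

end
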